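import Summits.QuantumFields.YangMills.Theses.TransportPerturbation
import Summits.QuantumFields.YangMills.Theorems.TransportPerturbationShadowAveragingCore
import Summits.QuantumFields.YangMills.Theorems.TransportPerturbationLoopStringLipschitz
import Summits.QuantumFields.YangMills.Theorems.TransportPerturbationDiscrepancyBounds
import Literature.MathematicalPhysics.QuantumFieldTheory.Balaban1983to89.T3CentreSymmetry
import Literature.MathematicalPhysics.QuantumFieldTheory.Balaban1983to89.T3DescentFibreTower

/-!
# Route `TransportPerturbation`, LINE «regular_shadow» (crux K2 `WeightedAlmostInvariance`, stmt-QuantumFields-26987):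
# support item `ShadowAveraging` (stmt-QuantumFields-27785) — PROVED BY NAME

Seat `ym-line-csu-p1` g5 (2026-08-28).  Rung R3 of LADDER-YM is a RECORD rung (leaf `YM3TorusSU2`): no summit, no continuum limit
and no mass gap is proved here; the line's load-bearing item `RegularWindowShadow` (stmt-QuantumFields-27784) is untouched.

WHAT.  `shadowAveraging_proof : ShadowAveraging`.  The measure theory is the route-independent core
`shadowAveraging_abstract` (`TransportPerturbationShadowAveragingCore.lean`); what this file adds is the ONE lattice fact the
item needs beyond it — in the corner `A < 0` the statement is true only because the weighted class `𝒢_K^Λ(A)` is EMPTY, i.e.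
because the pinned transport weight `S = wd_K` is not identically zero:
* §4 THE SEPARATING PAIR: `u₀ = 1` and `v₀ =` the 't Hooft centre twist of `1` by `−1 ∈ SU(2)` along a slice transverse to
  direction `0`.  Every iterate of the printed block average of `1` is `1` (`iter_blockAvg_one`, the induction of
  `T3DescentFibreTower.descendTo_one`), so every unit-scale averaged loop variable of `1` equals `1` (`avgObs_one`); by
  `T3CentreSymmetry.exists_ctwist_avgObs` the twist multiplies the straight Polyakov string (winding one, `wind_polyakov`) by
  `−1`; the landed Lipschitz bound `loopStringLipschitz_proof` (`|W u − W v| ≤ A₀·wd_K(u,v)`) then forces `wd_K(u₀,v₀) > 0`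
  (`exists_wd_pos`).
* §5 ASSEMBLY BY NAME: `S = wd_K ≤ 4` is the landed `discrepancyBounds_proof`.
No definitions, no named facts, no `sorry`.  References: G. 't Hooft, Nucl. Phys. B **153** (1979) §2 (centre twist);
T. Bałaban, CMP **98** (1985) 17–51, (12) p. 19 (gauge covariance of averages); M. Hairer, J. Mattingly, M. Scheutzow, PTRF
**149** (2011) [arXiv:0902.4495].
-/

set_option autoImplicit false

noncomputable section

open MeasureTheory
open scoped NNReal
open Literature.MathematicalPhysics.QuantumFieldTheory
open Literature.MathematicalPhysics.QuantumFieldTheory.Balaban1983to89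
open Literature.MathematicalPhysics.QuantumFieldTheory.Balaban1983to89.T4Continuum

namespace Summit.QuantumFields.YangMills.Theorems.TransportPerturbation

/-! ## §4 The transport weight `wd_K` separates the trivial configuration from its centre twist -/

section Separation

open Literature.MathematicalPhysics.QuantumFieldTheory.Balaban1983to89.T3ContinuumYM3Torus

/-- `Ū^k(1) = 1`: every iterate of the printed block average (`exp[mean log]`) of the trivial fine configuration is trivial
(the induction of `T3DescentFibreTower.descendTo_one`). [cite: Balaban1987RG1, (0.4) p.253] -/
theorem iter_blockAvg_one (F : T3Family) (K k : ℕ) :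
    Averaging.iter (fun i => BlockAveraging.blockAvg (P := F.P K) (j := i)
      (ExpMeanLog.expMeanLogSU : LoopAverage (Matrix.specialUnitaryGroup (Fin 2) ℂ))) k
      (1 : GaugeField (F.P K) 0 (Matrix.specialUnitaryGroup (Fin 2) ℂ)) = 1 := by
  induction k with
  | zero => rfl
  | succ k ih =>
    show (BlockAveraging.blockAvg (ExpMeanLog.expMeanLogSU : LoopAverage (Matrix.specialUnitaryGroup (Fin 2) ℂ))).avg
      (Averaging.iter (fun i => BlockAveraging.blockAvg (P := F.P K) (j := i)
        (ExpMeanLog.expMeanLogSU : LoopAverage (Matrix.specialUnitaryGroup (Fin 2) ℂ))) k 1) = 1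
    rw [ih, BlockAveraging.blockAvg_avg,
      T3DescentFibreTower.avgFun_one _ (fun n => T3DescentFibreTower.expMeanLogSU_E_one n)]

/-- `W̄_C(1) = 1`: every unit-scale averaged loop variable of the trivial configuration equals `1` (`Ū^K(1) = 1`, trivial
holonomy, `Re tr 1 / 2 = 1`). [cite: Balaban1987RG1, (0.4) p.253] -/
theorem avgObs_one (F : T3Family) (K : ℕ) (C : ULoop3 F) :
    F.avgObs (ExpMeanLog.expMeanLogSU : LoopAverage (Matrix.specialUnitaryGroup (Fin 2) ℂ)) K C 1 = 1 := by
  show loopAt (Averaging.iter (fun j => BlockAveraging.blockAvg (P := F.P K) (j := j)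
    (ExpMeanLog.expMeanLogSU : LoopAverage (Matrix.specialUnitaryGroup (Fin 2) ℂ))) K 1) (C.1.atLevel K) = 1
  rw [iter_blockAvg_one, loopAt, T3DescentFibreTower.holAt_one, GaugeGroup.reTr_one]

/-- **`wd_K` separates gauge-inequivalent configurations — an explicit pair.**  For every family `F` and step `K` the transport
weight `wd_K(u₀, v₀)` of the route is STRICTLY POSITIVE for `u₀ = 1` and `v₀ =` the 't Hooft centre twist of `1` by `−1 ∈ SU(2)`
along a slice transverse to direction `0`: the straight Polyakov string takes the values `1` and `−1` on them
(`T3CentreSymmetry.exists_ctwist_avgObs`, winding one), while it is `wd_K`-Lipschitz (`loopStringLipschitz_proof`).  Consequently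
the weighted classes `𝒢_K^Λ(A)` of the route are EMPTY for `A < 0`. [cite: tHooft1979Flux, §2] [cite: Balaban1985Averaging, (12) p.19] -/
theorem exists_wd_pos (F : T3Family) (K : ℕ) :
    ∃ u v : GaugeConfig 3 ((F.P K).sitesPerDir 0) (Matrix.specialUnitaryGroup (Fin 2) ℂ),
      0 < ∑ j ∈ Finset.range (K + 1), ((F.L : ℝ)⁻¹) ^ (K - j) *
        ⨅ h : GaugeTransf (F.P K) j (Matrix.specialUnitaryGroup (Fin 2) ℂ), ⨆ p : PBond (F.P K) j × Fin 2 × Fin 2,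
          ‖(((Averaging.iter (fun i => BlockAveraging.blockAvg (P := F.P K) (j := i) ExpMeanLog.expMeanLogSU) j
                (fun b : PBond (F.P K) 0 => u (b.src, b.dir))) p.1 : Matrix.specialUnitaryGroup (Fin 2) ℂ) :
                Matrix (Fin 2) (Fin 2) ℂ) p.2.1 p.2.2 -
            ((GaugeField.gaugeAct h (Averaging.iter (fun i => BlockAveraging.blockAvg (P := F.P K) (j := i)
                ExpMeanLog.expMeanLogSU) j (fun b : PBond (F.P K) 0 => v (b.src, b.dir))) p.1 :
                Matrix.specialUnitaryGroup (Fin 2) ℂ) : Matrix (Fin 2) (Fin 2) ℂ) p.2.1 p.2.2‖ := by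
  set ℰ : LoopAverage (Matrix.specialUnitaryGroup (Fin 2) ℂ) := ExpMeanLog.expMeanLogSU with hℰ
  obtain ⟨A₀, hA₀, hK⟩ := loopStringLipschitz_proof F [ULoop3.polyakov 0 default]
  obtain ⟨-, -, hlip⟩ := hK K
  obtain ⟨s₀, h₀⟩ := exists_ctwist_avgObs F ℰ negOne₂_comm negOne₂_mul_self reTr_negOne₂_mul 0 K
  set u₀ : GaugeConfig 3 ((F.P K).sitesPerDir 0) (Matrix.specialUnitaryGroup (Fin 2) ℂ) := fun _ => 1 with hu₀
  set v₀ : GaugeConfig 3 ((F.P K).sitesPerDir 0) (Matrix.specialUnitaryGroup (Fin 2) ℂ) :=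
    fun e => GaugeField.ctwist negOne₂ (0 : Fin 3) s₀
      (1 : GaugeField (F.P K) 0 (Matrix.specialUnitaryGroup (Fin 2) ℂ)) ⟨e.1, e.2⟩ with hv₀
  refine ⟨u₀, v₀, ?_⟩
  have h := hlip u₀ v₀
  have hfu : (fun b : PBond (F.P K) 0 => u₀ (b.src, b.dir)) =
      (1 : GaugeField (F.P K) 0 (Matrix.specialUnitaryGroup (Fin 2) ℂ)) := by
    funext b; rfl
  have hfv : (fun b : PBond (F.P K) 0 => v₀ (b.src, b.dir)) =
      GaugeField.ctwist negOne₂ (0 : Fin 3) s₀ (1 : GaugeField (F.P K) 0 (Matrix.specialUnitaryGroup (Fin 2) ℂ)) := by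
    funext b; rfl
  have hu : ([ULoop3.polyakov 0 default].map fun C : ULoop3 F =>
      F.avgObs ℰ K C (fun b : PBond (F.P K) 0 => u₀ (b.src, b.dir))).prod = 1 := by
    rw [hfu, List.map_cons, List.map_nil, List.prod_cons, List.prod_nil, mul_one, avgObs_one]
  have hv : ([ULoop3.polyakov 0 default].map fun C : ULoop3 F =>
      F.avgObs ℰ K C (fun b : PBond (F.P K) 0 => v₀ (b.src, b.dir))).prod = -1 := by
    rw [hfv, List.map_cons, List.map_nil, List.prod_cons, List.prod_nil, mul_one, h₀, avgObs_one,
      ULoop3.wind_polyakov]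
    norm_num
  rw [hu, hv, show |(1 : ℝ) - -1| = 2 by norm_num] at h
  by_contra hle
  replace hle := not_lt.1 hle
  have : A₀ * (∑ j ∈ Finset.range (K + 1), ((F.L : ℝ)⁻¹) ^ (K - j) *
        ⨅ h : GaugeTransf (F.P K) j (Matrix.specialUnitaryGroup (Fin 2) ℂ), ⨆ p : PBond (F.P K) j × Fin 2 × Fin 2,
          ‖(((Averaging.iter (fun i => BlockAveraging.blockAvg (P := F.P K) (j := i) ExpMeanLog.expMeanLogSU) j
                (fun b : PBond (F.P K) 0 => u₀ (b.src, b.dir))) p.1 : Matrix.specialUnitaryGroup (Fin 2) ℂ) :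
                Matrix (Fin 2) (Fin 2) ℂ) p.2.1 p.2.2 -
            ((GaugeField.gaugeAct h (Averaging.iter (fun i => BlockAveraging.blockAvg (P := F.P K) (j := i)
                ExpMeanLog.expMeanLogSU) j (fun b : PBond (F.P K) 0 => v₀ (b.src, b.dir))) p.1 :
                Matrix.specialUnitaryGroup (Fin 2) ℂ) : Matrix (Fin 2) (Fin 2) ℂ) p.2.1 p.2.2‖) ≤ 0 := mul_nonpos_of_nonneg_of_nonpos hA₀ hle
  linarith

end Separation

/-! ## §5 Assembly BY NAME -/

/-- ★★ **`ShadowAveraging` (stmt-QuantumFields-27785)** BY NAME: the averaging step of LINE «regular_shadow» — `S = wd_K ≤ 4`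
(`discrepancyBounds_proof`), `wd_K` separates a pair (`exists_wd_pos`), and the abstract averaging lemma
`shadowAveraging_abstract`. [cite: HairerMattinglyScheutzow2011, §4] [cite: RudolfSchweizer2018, Thm 3.1] -/
theorem shadowAveraging_proof : Summit.QuantumFields.YangMills.Theses.TransportPerturbation.ShadowAveraging := by
  intro F K S hS X Xc Ω Ω' _ _ _ _ μ P P' hμ hP hP' V t V' t' E Dc D R e ρ hV hV' hE hDc hD hR he hρ hmass hpt hwin
    Λ hΛm hΛ0 hΛM A g hg
  haveI := hμ
  haveI := hP
  haveI := hP'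
  subst hS
  have hS4 := fun u v => (discrepancyBounds_proof F K u v).2
  obtain ⟨u₁, v₁, hsep⟩ := exists_wd_pos F K
  exact shadowAveraging_abstract _ hS4 ⟨u₁, v₁, hsep⟩ μ P P' V t V' t' E Dc D R e ρ hV hV' hE hDc hD hR he hρ hmass
    hpt hwin Λ hΛm hΛ0 hΛM A g hg

end Summit.QuantumFields.YangMills.Theorems.TransportPerturbation

end
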